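import Summits.CriticalPhenomena.PercolationContinuityZ3.Theorems.PercNearOneGluingNoHeavyQuantRCMStep
import HarnessLib

/-!
# QUANT lane R8, T-DEC: THE WIDTH-2 RCM CERTIFICATE — arm-1 g45's two-root identity IS a re-gating count-mixture certificate in the typed
# format `LawDec.RCMCert` (template and sanity check of `…QuantRCMStep`)

builds on p205010 (kernel theorem, internal audit signed; external expert review pending)

Support file (`--supports stmt-CriticalPhenomena-4575`), QUANT lane typer seat prim-quant-stmt (gen 39), rung R8 of
`run/shared/lean/prim/quant/LADDER.md`.  Theorems only, standard axioms, no sorries, no definitions.  Uses arm-1 g45's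
`twoRoot_gateCoupling` (✓ p392934) and typer g39's `RCMComponent` / `RCMCert` / `sdec_of_rcmCert` (`…QuantRCMStep`).

README V400 describes the RCM conjecture with "width 1: the gate merge; width 2: arm-1's identity; width ≥ 3: LP certificates, closed form
OPEN".  This file checks the WIDTH-2 clause against the typed format, as the template for landing closed-form families:

* **`rcmCert_twoRoot`** — for two sibling trees `gate ρ₁ q₁`, `gate ρ₂ q₂` (`ρᵢ` tree-built with `nᵢ` gates at floors `xᵢ`, `0 < q₂ ≤ q₁ < 1`,
  floor `x ≤ qᵢ·xᵢ`) and every outer gate `0 < a < 1`, `RCMCert (n₁ + n₂ + 2) x (M₁ + M₂) (gate ρ₁ q₁ ∗ gate ρ₂ q₂) a` holds with the TWO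
  components of the two-root identity: `P = gate_{aq₁}ρ₁ ∗ gate_{aq₂}ρ₂` (weight `(1−q₁)/(1−aq₁)`; `n₁ + n₂ + 2` gates) and
  `U = gate_{aq₁}(ρ₁ ∗ gate_{q₂/q₁}ρ₂)` (the opened-heavier-root forest re-hung under one root; `≤ n₁ + n₂ + 2` gates), both of mean
  `a·(q₁S₁ + q₂S₂)` and floor `a·x`.
* `sdec_twoRoot_of_oracle` — hence (by `sdec_of_rcmCert`) the two-sibling forest is SDEC at `x` given the oracle below `n₁ + n₂ + 2`:
  a second kernel route to the width-2 case (the first is `gateStepN_of_tree` via `sdec_twoRoot_of_opened`).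

HONEST STATUS: nothing new is closed (width 2 was free since ✓ p392934); `RCMStep`, `SiblingStep`, `FarTreeRow` OPEN; the RATE class
log\* and the honest sentence of `run/shared/lean/prim/quant/README.md` are unchanged.
[this work]; the identity is prim-quant-arm-1 g45's (= typer g25's `gate_lconv_split` read inductively).  Nothing here is cited as a
published result.  The gluing rows served [cite: KozmaNitzan2024, Conjecture 3 (p. 15)]; product measure [cite: Grimmett1999, §1.3 p. 10].
-/

noncomputable section

namespace Summit.CriticalPhenomena.PercolationContinuityZ3.Theorems
namespace Quant
namespace LawDec

open Finset

/-- **THE WIDTH-2 RCM CERTIFICATE** (the two-root identity in the format `RCMCert`). [this work] -/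
theorem rcmCert_twoRoot {x x₁ x₂ q₁ q₂ : ℝ} {n₁ n₂ M₁ M₂ : ℕ} {ρ₁ ρ₂ : ℕ → ℝ}
    (hx0 : 0 < x) (hq₂0 : 0 < q₂) (hq₂₁ : q₂ ≤ q₁) (hq₁1 : q₁ < 1) (hx₁ : x ≤ q₁ * x₁) (hx₂ : x ≤ q₂ * x₂)
    (hρ₁ : TreeBuiltN x₁ n₁ M₁ ρ₁) (hρ₂ : TreeBuiltN x₂ n₂ M₂ ρ₂) {a : ℝ} (ha0 : 0 < a) (ha1 : a < 1) :
    RCMCert (n₁ + n₂ + 2) x (M₁ + M₂) (lconv M₁ M₂ (gate ρ₁ q₁) (gate ρ₂ q₂)) a := by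
  classical
  have hq₁0 : 0 < q₁ := lt_of_lt_of_le hq₂0 hq₂₁
  obtain ⟨hx₁0, hx₁1, _, h₁M, h₁1, _⟩ := hρ₁.lawFacts
  obtain ⟨hx₂0, hx₂1, _, h₂M, h₂1, _⟩ := hρ₂.lawFacts
  have haq₁ : a * q₁ < 1 := by nlinarith
  have haq₂ : a * q₂ < 1 := by nlinarith
  have hax0 : 0 < a * x := mul_pos ha0 hx0
  -- the weight
  set ω : ℝ := (1 - q₁) / (1 - a * q₁) with hω
  have hden : 0 < 1 - a * q₁ := by linarith
  have hω0 : 0 ≤ ω := div_nonneg (by linarith) hden.le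
  have hω1 : ω ≤ 1 := by
    rw [hω, div_le_one hden]; nlinarith
  -- the two components
  set P : ℕ → ℝ := lconv M₁ M₂ (gate ρ₁ (a * q₁)) (gate ρ₂ (a * q₂)) with hP
  set U : ℕ → ℝ := gate (lconv M₁ M₂ ρ₁ (gate ρ₂ (q₂ / q₁))) (a * q₁) with hU
  -- means
  set S₁ : ℝ := ∑ h ∈ Finset.range (M₁ + 1), (h : ℝ) * ρ₁ h with hS₁
  set S₂ : ℝ := ∑ h ∈ Finset.range (M₂ + 1), (h : ℝ) * ρ₂ h with hS₂
  have hmeanμ : ∑ h ∈ Finset.range (M₁ + M₂ + 1), (h : ℝ) * lconv M₁ M₂ (gate ρ₁ q₁) (gate ρ₂ q₂) h = q₁ * S₁ + q₂ * S₂ := by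
    rw [sum_mul_lconv M₁ M₂ _ _ (sum_gate ρ₁ q₁ M₁ h₁1) (sum_gate ρ₂ q₂ M₂ h₂1), sum_mul_gate, sum_mul_gate]
  have hmeanP : ∑ h ∈ Finset.range (M₁ + M₂ + 1), (h : ℝ) * P h = a * (q₁ * S₁ + q₂ * S₂) := by
    rw [hP, sum_mul_lconv M₁ M₂ _ _ (sum_gate ρ₁ _ M₁ h₁1) (sum_gate ρ₂ _ M₂ h₂1), sum_mul_gate, sum_mul_gate]
    ring
  have hmeanU : ∑ h ∈ Finset.range (M₁ + M₂ + 1), (h : ℝ) * U h = a * (q₁ * S₁ + q₂ * S₂) := by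
    rw [hU, sum_mul_gate, sum_mul_lconv M₁ M₂ _ _ h₁1 (sum_gate ρ₂ _ M₂ h₂1), sum_mul_gate]
    field_simp
    ring
  -- `P` is tree-built at floor `a·x` with `n₁ + n₂ + 2` gates
  have hTP : TreeBuiltN (a * x) (n₁ + 1 + (n₂ + 1)) (M₁ + M₂) P := by
    refine TreeBuiltN.conv ?_ ?_
    · exact TreeBuiltN.mono (TreeBuiltN.gate (a * q₁) (mul_pos ha0 hq₁0) haq₁ hρ₁) hax0 (by nlinarith [mul_le_mul_of_nonneg_left hx₁ ha0.le])
    · exact TreeBuiltN.mono (TreeBuiltN.gate (a * q₂) (mul_pos ha0 hq₂0) haq₂ hρ₂) hax0 (by nlinarith [mul_le_mul_of_nonneg_left hx₂ ha0.le])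
  -- `U` is tree-built at floor `a·x` with `≤ n₁ + n₂ + 2` gates: the inner forest lives at floor `x/q₁`
  have hw0 : 0 < x / q₁ := div_pos hx0 hq₁0
  have hρ₁' : TreeBuiltN (x / q₁) n₁ M₁ ρ₁ :=
    TreeBuiltN.mono hρ₁ hw0 (by rw [div_le_iff₀ hq₁0]; linarith [mul_comm q₁ x₁])
  have hTU : ∃ m, m ≤ n₁ + n₂ + 2 ∧ TreeBuiltN (a * x) m (M₁ + M₂) U := by
    have e : a * q₁ * (x / q₁) = a * x := by field_simp
    rcases eq_or_lt_of_le hq₂₁ with hq | hq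
    · -- tie `q₂ = q₁`: no re-gate
      have hρ₂' : TreeBuiltN (x / q₁) n₂ M₂ (gate ρ₂ (q₂ / q₁)) := by
        rw [hq, div_self hq₁0.ne', gate_one]
        exact TreeBuiltN.mono hρ₂ hw0 (by rw [div_le_iff₀ hq₁0, ← hq]; linarith [mul_comm q₂ x₂])
      refine ⟨n₁ + n₂ + 1, by omega, ?_⟩
      have := TreeBuiltN.gate (a * q₁) (mul_pos ha0 hq₁0) haq₁ (TreeBuiltN.conv hρ₁' hρ₂')
      rwa [e] at this
    · have hr0 : 0 < q₂ / q₁ := div_pos hq₂0 hq₁0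
      have hr1 : q₂ / q₁ < 1 := by rw [div_lt_one hq₁0]; exact hq
      have hρ₂' : TreeBuiltN (x / q₁) (n₂ + 1) M₂ (gate ρ₂ (q₂ / q₁)) := by
        refine TreeBuiltN.mono (TreeBuiltN.gate (q₂ / q₁) hr0 hr1 hρ₂) hw0 ?_
        rw [div_mul_eq_mul_div, le_div_iff₀ hq₁0, div_mul_cancel₀ x hq₁0.ne']
        exact hx₂
      refine ⟨n₁ + (n₂ + 1) + 1, by omega, ?_⟩
      have := TreeBuiltN.gate (a * q₁) (mul_pos ha0 hq₁0) haq₁ (TreeBuiltN.conv hρ₁' hρ₂')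
      rwa [e] at this
  -- assemble the certificate on `Bool`: `true ↦ (ω, P)`, `false ↦ (1 − ω, U)`
  have hgM : ∀ q : ℝ, ∀ k, M₂ < k → gate ρ₂ q k = 0 := by
    intro q k hk; simp only [LawDec.gate]; rw [h₂M k hk, if_neg (by omega)]; ring
  refine ⟨Bool, inferInstance, fun b => if b then ω else 1 - ω, fun b => if b then P else U, ?_, ?_, ?_, ?_⟩
  · intro b; cases b <;> simp only [Bool.false_eq_true, if_false, if_true] <;> linarith
  · simp only [Fintype.sum_bool, if_true, Bool.false_eq_true, if_false]; ring
  · intro b _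
    cases b
    · simp only [Bool.false_eq_true, if_false]
      obtain ⟨m, hm, hT⟩ := hTU
      exact ⟨a * x, m, M₁ + M₂, hm, le_rfl, le_rfl, hT, by rw [hmeanU, hmeanμ]⟩
    · simp only [if_true]
      exact ⟨a * x, n₁ + 1 + (n₂ + 1), M₁ + M₂, by omega, le_rfl, le_rfl, hTP, by rw [hmeanP, hmeanμ]⟩
  · intro h
    simp only [Fintype.sum_bool, if_true, Bool.false_eq_true, if_false]
    rw [hP, hU, hω]
    exact twoRoot_gateCoupling M₁ M₂ ρ₁ ρ₂ q₁ q₂ a h₁M h₂M hq₁0.ne' hden.ne' h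

/-- **the two-sibling forest is SDEC from the oracle, via the RCM route** (second kernel route to width 2; the first is `gateStepN_of_tree`).
[this work] -/
theorem sdec_twoRoot_of_oracle {x x₁ x₂ q₁ q₂ : ℝ} {n₁ n₂ M₁ M₂ : ℕ} {ρ₁ ρ₂ : ℕ → ℝ} (n : ℕ)
    (hO : ∀ (x' : ℝ) (n' M' : ℕ) (μ' : ℕ → ℝ), n' < n → TreeBuiltN x' n' M' μ' → SDEC x' M' μ')
    (hn : n₁ + n₂ + 2 ≤ n)
    (hx0 : 0 < x) (hq₂0 : 0 < q₂) (hq₂₁ : q₂ ≤ q₁) (hq₁1 : q₁ < 1) (hx₁ : x ≤ q₁ * x₁) (hx₂ : x ≤ q₂ * x₂)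
    (hρ₁ : TreeBuiltN x₁ n₁ M₁ ρ₁) (hρ₂ : TreeBuiltN x₂ n₂ M₂ ρ₂) :
    SDEC x (M₁ + M₂) (lconv M₁ M₂ (gate ρ₁ q₁) (gate ρ₂ q₂)) := by
  have hq₁0 : 0 < q₁ := lt_of_lt_of_le hq₂0 hq₂₁
  have hT : TreeBuiltN x (n₁ + 1 + (n₂ + 1)) (M₁ + M₂) (lconv M₁ M₂ (gate ρ₁ q₁) (gate ρ₂ q₂)) :=
    TreeBuiltN.conv (TreeBuiltN.mono (TreeBuiltN.gate q₁ hq₁0 hq₁1 hρ₁) hx0 hx₁)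
      (TreeBuiltN.mono (TreeBuiltN.gate q₂ hq₂0 (lt_of_le_of_lt hq₂₁ hq₁1) hρ₂) hx0 hx₂)
  have hO' : ∀ (x' : ℝ) (n' M' : ℕ) (μ' : ℕ → ℝ), n' < n₁ + n₂ + 2 → TreeBuiltN x' n' M' μ' → SDEC x' M' μ' :=
    fun x' n' M' μ' hlt h' => hO x' n' M' μ' (by omega) h'
  exact sdec_of_rcmCert (n₁ + n₂ + 2) hO' hT (by omega) (fun a ha0 ha1 => rcmCert_twoRoot hx0 hq₂0 hq₂₁ hq₁1 hx₁ hx₂ hρ₁ hρ₂ ha0 ha1)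

end LawDec
end Quant
end Summit.CriticalPhenomena.PercolationContinuityZ3.Theorems
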